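import Mathlib
import HarnessLib
import Summits.AtomisticToContinuum.Crystallization.Theorems.PricedLinkCensusSoftFourRingsRigRows

/-!
# Soft four-rings, metric half by certified numerics (4): soundness of rows and certificates

Route `PricedLinkCensus`, sub-problem `Crystallization`, item `SoftFourRings`
(stmt-AtomisticToContinuum-14234).  For a configuration `x : Fin 12 → ℝ³` of unit vectors obeying
the one-percent windows (`Feasible bond x`) and lying in the checker's boxes (`bx.mem x`):

* `rows_hold` — every row of `rowsOf bond bx` holds for the displacement field `bx.disp x`;
* `certUpper_sound` — for ANY certificate, `Σ obj·d ≤ certUpper …/S`;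
* `certInfeasible_sound` — an accepted Farkas certificate is contradictory.
-/

namespace Summit.AtomisticToContinuum.Crystallization.Theorems

namespace Rig

open Literature.Analysis.ValidatedNumerics.NumericsMP
open scoped Matrix
/-! ### Semantics -/

/-- **Feasibility at one percent** for the bond relation `bond`: unit vectors, bonded pairs in
`[cbloR, chiR]`, non-bonded pairs `≤ cnbR` (stated for `i < j`). -/
def Feasible (bond : Fin 12 → Fin 12 → Bool) (x : Fin 12 → Fin 3 → ℝ) : Prop :=
  (∀ i, x i ⬝ᵥ x i = 1) ∧
  (∀ i j, i < j → bond i j = true → cbloR ≤ x i ⬝ᵥ x j ∧ x i ⬝ᵥ x j ≤ chiR) ∧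
  (∀ i j, i < j → bond i j = false → x i ⬝ᵥ x j ≤ cnbR)

/-- The displacement field of `x` relative to the boxes (zero at unplaced points). -/
noncomputable def Boxes.disp (bx : Boxes) (x : Fin 12 → Fin 3 → ℝ) : Fin 12 → Fin 3 → ℝ :=
  fun v k => if bx.placed v then x v k - bx.c v k else 0

/-- The box condition on a displacement field: `LO ≤ d·S ≤ HI` everywhere. -/
def Boxes.DispIn (bx : Boxes) (d : Fin 12 → Fin 3 → ℝ) : Prop :=
  ∀ v k, (bx.LO v k : ℝ) ≤ d v k * SC ∧ d v k * SC ≤ (bx.HI v k : ℝ)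

/-- Unplaced points have the junk interval `zeroI`, hence `C = LO = HI = 0`. -/
theorem Boxes.ivl_of_none {bx : Boxes} {v : Fin 12} (h : bx v = none) (k : Fin 3) :
    bx.ivl v k = zeroI := by
  simp [Boxes.ivl, h]

/-- Placed points: the interval is the box coordinate. -/
theorem Boxes.ivl_of_some {bx : Boxes} {v : Fin 12} {B : IVec} (h : bx v = some B) (k : Fin 3) :
    bx.ivl v k = B.get k := by
  simp [Boxes.ivl, h]

/-- **Configurations in the boxes have displacement in the box.** -/
theorem Boxes.dispIn_of_mem {bx : Boxes} {x : Fin 12 → Fin 3 → ℝ} (hx : bx.mem x) :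
    bx.DispIn (bx.disp x) := by
  intro v k
  have hS : (0 : ℝ) < SC := by exact_mod_cast SC_pos
  unfold Boxes.disp Boxes.LO Boxes.HI Boxes.c
  cases hv : bx v with
  | none =>
    have hp : bx.placed v = false := by simp [Boxes.placed, hv]
    simp only [hp]
    have hC : bx.C v k = 0 := by simp [Boxes.C, Boxes.ivl_of_none hv, zeroI]
    simp [Boxes.ivl_of_none hv, zeroI, hC]
  | some B =>
    have hp : bx.placed v = true := by simp [Boxes.placed, hv]
    simp only [hp, if_true]
    obtain ⟨h1, h2⟩ := hx v B hv k
    rw [Boxes.ivl_of_some hv]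
    push_cast
    constructor
    · have : (x v k - (bx.C v k : ℝ) / SC) * SC = x v k * SC - bx.C v k := by field_simp
      rw [this]; linarith
    · have : (x v k - (bx.C v k : ℝ) / SC) * SC = x v k * SC - bx.C v k := by field_simp
      rw [this]; linarith

/-- `|d·S| ≤ R`. -/
theorem abs_disp_le_R {bx : Boxes} {d : Fin 12 → Fin 3 → ℝ} (hd : bx.DispIn d) (v : Fin 12)
    (k : Fin 3) : |d v k * SC| ≤ (bx.R v k : ℝ) := by
  obtain ⟨h1, h2⟩ := hd v k
  unfold Boxes.R
  push_cast
  rw [abs_le]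
  constructor
  · have : -(max |(bx.LO v k : ℝ)| |(bx.HI v k : ℝ)|) ≤ (bx.LO v k : ℝ) := by
      have := neg_abs_le (bx.LO v k : ℝ)
      have := le_max_left |(bx.LO v k : ℝ)| |(bx.HI v k : ℝ)|
      linarith
    linarith
  · exact h2.trans ((le_abs_self _).trans (le_max_right _ _))

/-- A placed coordinate is `c + d`. -/
theorem Boxes.coord_eq {bx : Boxes} {x : Fin 12 → Fin 3 → ℝ} {v : Fin 12} (hv : bx.placed v = true)
    (k : Fin 3) : x v k = bx.c v k + bx.disp x v k := by
  simp [Boxes.disp, hv]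
/-! ### Elementary inequalities -/

/-- `S² · (d_i ⬝ d_j) ≥ −rem`. -/
theorem neg_rem_le {bx : Boxes} {d : Fin 12 → Fin 3 → ℝ} (hd : bx.DispIn d) (i j : Fin 12) :
    -(rem bx i j : ℝ) ≤ (SC : ℝ) * SC * ∑ k, d i k * d j k := by
  unfold rem
  push_cast
  rw [Finset.mul_sum, ← Finset.sum_neg_distrib]
  refine Finset.sum_le_sum fun k _ => ?_
  have ha := abs_disp_le_R hd i k
  have h : |d i k * SC * (d j k * SC)| ≤ (bx.R i k : ℝ) * bx.R j k := by
    rw [abs_mul]; exact mul_le_mul ha (abs_disp_le_R hd j k) (abs_nonneg _) ((abs_nonneg _).trans ha)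
  have : d i k * SC * (d j k * SC) = (SC : ℝ) * SC * (d i k * d j k) := by ring
  linarith [neg_abs_le (d i k * SC * (d j k * SC))]

/-- `S² · (d_i ⬝ d_j) ≤ rem`. -/
theorem le_rem {bx : Boxes} {d : Fin 12 → Fin 3 → ℝ} (hd : bx.DispIn d) (i j : Fin 12) :
    (SC : ℝ) * SC * ∑ k, d i k * d j k ≤ (rem bx i j : ℝ) := by
  unfold rem
  push_cast
  rw [Finset.mul_sum]
  refine Finset.sum_le_sum fun k _ => ?_
  have ha := abs_disp_le_R hd i k
  have hb := abs_disp_le_R hd j k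
  have h : |d i k * SC * (d j k * SC)| ≤ (bx.R i k : ℝ) * bx.R j k := by
    rw [abs_mul]; exact mul_le_mul ha hb (abs_nonneg _) ((abs_nonneg _).trans ha)
  have : d i k * SC * (d j k * SC) = (SC : ℝ) * SC * (d i k * d j k) := by ring
  rw [this] at h
  exact (le_abs_self _).trans h

/-- `rem ≥ 0`. -/
theorem rem_nonneg (bx : Boxes) (i j : Fin 12) : (0 : ℝ) ≤ rem bx i j := by
  unfold rem; push_cast
  refine Finset.sum_nonneg fun k _ => mul_nonneg ?_ ?_ <;>
  · unfold Boxes.R; push_cast; exact (abs_nonneg _).trans (le_max_left _ _)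
/-! ### Linear forms of the rows -/

/-- The pair-row form: `Σ pairCoeff·d = Σ_k (C_jk d_ik + C_ik d_jk)`. -/
theorem sum_pairCoeff (bx : Boxes) (i j : Fin 12) (d : Fin 12 → Fin 3 → ℝ) :
    (∑ v, ∑ k, (pairCoeff bx i j v k : ℝ) * d v k) =
      ∑ k, ((bx.C j k : ℝ) * d i k + (bx.C i k : ℝ) * d j k) := by
  unfold pairCoeff
  push_cast
  simp only [add_mul, ite_mul, zero_mul, Finset.sum_add_distrib]
  rw [Finset.sum_comm (f := fun v k => if v = i then (bx.C j k : ℝ) * d v k else 0),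
    Finset.sum_comm (f := fun v k => if v = j then (bx.C i k : ℝ) * d v k else 0)]
  simp [Finset.sum_ite_eq']

/-- The sphere-row form: `Σ (if v = i then 2C else 0)·d = 2 Σ_k C_ik d_ik`. -/
theorem sum_sphereCoeff (bx : Boxes) (i : Fin 12) (d : Fin 12 → Fin 3 → ℝ) :
    (∑ v, ∑ k, ((if v = i then 2 * bx.C i k else 0 : ℤ) : ℝ) * d v k) =
      2 * ∑ k, (bx.C i k : ℝ) * d i k := by
  push_cast
  simp only [ite_mul, zero_mul]
  rw [Finset.sum_comm]
  simp [Finset.sum_ite_eq', Finset.mul_sum, mul_assoc]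

/-- The negated sphere-row form. -/
theorem sum_sphereCoeff_neg (bx : Boxes) (i : Fin 12) (d : Fin 12 → Fin 3 → ℝ) :
    (∑ v, ∑ k, ((if v = i then -(2 * bx.C i k) else 0 : ℤ) : ℝ) * d v k) =
      -(2 * ∑ k, (bx.C i k : ℝ) * d i k) := by
  push_cast
  simp only [ite_mul, zero_mul]
  rw [Finset.sum_comm]
  simp [Finset.sum_ite_eq', Finset.mul_sum, mul_assoc, Finset.sum_neg_distrib]

/-- Expansion of an inner product of placed points: `x_i ⬝ x_j = c·c/S²·… ` in the form
`S² (x_i ⬝ x_j) = c0 + S Σ_k (C_jk d_ik + C_ik d_jk) + S² Σ_k d_ik d_jk`. -/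
theorem inner_expand {bx : Boxes} {x : Fin 12 → Fin 3 → ℝ} {i j : Fin 12}
    (hi : bx.placed i = true) (hj : bx.placed j = true) :
    (SC : ℝ) * SC * (x i ⬝ᵥ x j) = (c0 bx i j : ℝ) +
      SC * (∑ k, ((bx.C j k : ℝ) * bx.disp x i k + (bx.C i k : ℝ) * bx.disp x j k)) +
      (SC : ℝ) * SC * ∑ k, bx.disp x i k * bx.disp x j k := by
  have hS : (SC : ℝ) ≠ 0 := by exact_mod_cast SC_pos.ne'
  unfold c0 dotProduct
  push_cast
  rw [Finset.mul_sum, Finset.mul_sum, Finset.mul_sum, ← Finset.sum_add_distrib, ← Finset.sum_add_distrib]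
  refine Finset.sum_congr rfl fun k _ => ?_
  rw [Boxes.coord_eq (x := x) hi k, Boxes.coord_eq (x := x) hj k]
  unfold Boxes.c
  field_simp
  ring
/-! ### Rows hold -/

/-- **Every canonical row holds** for a feasible configuration in the boxes. -/
theorem rows_hold {bond : Fin 12 → Fin 12 → Bool} {bx : Boxes} {x : Fin 12 → Fin 3 → ℝ}
    (hF : Feasible bond x) (hx : bx.mem x) :
    ∀ r ∈ rowsOf bond bx, r.Holds (bx.disp x) := by
  have hS : (0 : ℝ) < SC := by exact_mod_cast SC_pos
  have hS2 : (0 : ℝ) < (SC : ℝ) * SC := mul_pos hS hS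
  have hd := Boxes.dispIn_of_mem hx
  obtain ⟨hunit, hbond, hnb⟩ := hF
  intro r hr
  unfold rowsOf at hr
  rw [List.mem_append] at hr
  rcases hr with hr | hr
  · -- pair rows
    rw [List.mem_flatMap] at hr
    obtain ⟨⟨i, j⟩, hp, hr⟩ := hr
    have hij : i < j := by
      unfold allPairs at hp
      simp only [List.mem_flatMap, List.mem_finRange, List.mem_filterMap, true_and] at hp
      obtain ⟨i', j', h⟩ := hp
      by_cases hlt : i' < j'
      · rw [if_pos hlt] at h; simp only [Option.some.injEq, Prod.mk.injEq] at h
        obtain ⟨rfl, rfl⟩ := h; exact hlt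
      · rw [if_neg hlt] at h; exact absurd h (by simp)
    have hne : i ≠ j := ne_of_lt hij
    simp only at hr
    by_cases hpl : (bx.placed i && bx.placed j) = true
    · rw [if_pos hpl] at hr
      rw [Bool.and_eq_true] at hpl
      obtain ⟨hpi, hpj⟩ := hpl
      have hexp := inner_expand (x := x) hpi hpj
      have hremle := neg_rem_le hd i j
      unfold pairRows at hr
      by_cases hb : bond i j = true
      · rw [if_pos hb] at hr
        obtain ⟨hlo, hhi⟩ := hbond i j hij hb
        simp only [List.mem_cons, List.mem_nil_iff, or_false] at hr
        rcases hr with rfl | rfl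
        · -- upper bond row
          unfold Row.Holds
          rw [sum_pairCoeff, le_div_iff₀ hS]
          push_cast
          have h1 : (SC : ℝ) * SC * (x i ⬝ᵥ x j) ≤ CHI2 := by
            have := chi_le_CHI2; nlinarith
          nlinarith [hexp, h1, hremle]
        · -- lower bond row
          unfold Row.Holds
          have hneg : (∑ v, ∑ k, ((-pairCoeff bx i j v k : ℤ) : ℝ) * bx.disp x v k) =
              -∑ v, ∑ k, (pairCoeff bx i j v k : ℝ) * bx.disp x v k := by
            push_cast
            simp only [neg_mul, Finset.sum_neg_distrib]
          rw [hneg, sum_pairCoeff, le_div_iff₀ hS]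
          push_cast
          have h1 : (CBLO2 : ℝ) ≤ (SC : ℝ) * SC * (x i ⬝ᵥ x j) := by
            have := CBLO2_le_cblo; nlinarith
          have hremge := le_rem hd i j
          nlinarith [hexp, h1, hremge]
      · rw [if_neg hb] at hr
        simp only [List.mem_cons, List.mem_nil_iff, or_false] at hr
        subst hr
        have hb' : bond i j = false := by simpa using hb
        have hle := hnb i j hij hb'
        unfold Row.Holds
        rw [sum_pairCoeff, le_div_iff₀ hS]
        push_cast
        have h1 : (SC : ℝ) * SC * (x i ⬝ᵥ x j) ≤ CNB2 := by
          have := cnb_le_CNB2; nlinarith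
        nlinarith [hexp, h1, hremle]
    · rw [if_neg hpl] at hr; exact absurd hr (by simp)
  · -- sphere rows
    rw [List.mem_flatMap] at hr
    obtain ⟨i, -, hr⟩ := hr
    by_cases hpi : bx.placed i = true
    · rw [if_pos hpi] at hr
      have hexp := inner_expand (x := x) hpi hpi
      rw [hunit i, mul_one] at hexp
      have hremle := neg_rem_le hd i i
      have hsq : (0 : ℝ) ≤ ∑ k, bx.disp x i k * bx.disp x i k :=
        Finset.sum_nonneg fun k _ => mul_self_nonneg _
      have hsym : (∑ k, ((bx.C i k : ℝ) * bx.disp x i k + (bx.C i k : ℝ) * bx.disp x i k)) =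
          2 * ∑ k, (bx.C i k : ℝ) * bx.disp x i k := by
        rw [two_mul, ← Finset.sum_add_distrib]
      rw [hsym] at hexp
      unfold sphereRows at hr
      simp only [List.mem_cons, List.mem_nil_iff, or_false] at hr
      rcases hr with rfl | rfl
      · unfold Row.Holds
        rw [sum_sphereCoeff, le_div_iff₀ hS]
        push_cast
        nlinarith [hexp, hsq]
      · unfold Row.Holds
        rw [sum_sphereCoeff_neg, le_div_iff₀ hS]
        push_cast
        have hremge := le_rem hd i i
        nlinarith [hexp, hremge]
    · rw [if_neg hpi] at hr; exact absurd hr (by simp)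

/-! ### Safe bounds -/

/-- The dual combination, summed against `d`: `Σ_{v,k} termCoeff·d = Σ_t Y_t (Σ a_t·d)`, and
the latter is at most `dualBound/S` when all rows hold. -/
theorem termCoeff_sum_le {rows : Array Row} {d : Fin 12 → Fin 3 → ℝ}
    (hrows : ∀ r ∈ rows, r.Holds d) :
    ∀ terms : List (ℕ × ℕ),
      (∑ v, ∑ k, (termCoeff rows terms v k : ℝ) * d v k) ≤ (dualBound rows terms : ℝ) / SC := by
  have hS : (0 : ℝ) < SC := by exact_mod_cast SC_pos
  intro terms
  induction terms with
  | nil => simp [termCoeff, dualBound]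
  | cons t ts ih =>
    simp only [termCoeff, dualBound]
    push_cast
    simp only [add_mul, Finset.sum_add_distrib]
    rw [add_div]
    refine add_le_add ?_ ih
    cases hrt : rows[t.1]? with
    | none => simp
    | some r =>
      simp only
      have hmem : r ∈ rows := Array.mem_of_getElem? hrt
      have hh := hrows r hmem
      unfold Row.Holds at hh
      push_cast
      have hY : (0 : ℝ) ≤ (t.2 : ℝ) := by exact_mod_cast Nat.zero_le _
      calc (∑ v, ∑ k, (t.2 : ℝ) * (r.a v k : ℝ) * d v k)
          = (t.2 : ℝ) * ∑ v, ∑ k, (r.a v k : ℝ) * d v k := by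
            rw [Finset.mul_sum]; refine Finset.sum_congr rfl fun v _ => ?_
            rw [Finset.mul_sum]; refine Finset.sum_congr rfl fun k _ => ?_; ring
        _ ≤ (t.2 : ℝ) * ((r.ub : ℝ) / SC) := mul_le_mul_of_nonneg_left hh hY
        _ = (t.2 : ℝ) * (r.ub : ℝ) / SC := by ring

/-- The box slack dominates the residual paired with `d`. -/
theorem residual_sum_le_boxSlack {bx : Boxes} {d : Fin 12 → Fin 3 → ℝ} (hd : bx.DispIn d)
    (r : Fin 12 → Fin 3 → ℤ) :
    (∑ v, ∑ k, (r v k : ℝ) * d v k) ≤ (boxSlack bx r : ℝ) / SC := by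
  have hS : (0 : ℝ) < SC := by exact_mod_cast SC_pos
  unfold boxSlack
  push_cast
  rw [Finset.sum_div]
  refine Finset.sum_le_sum fun v _ => ?_
  rw [Finset.sum_div]
  refine Finset.sum_le_sum fun k _ => ?_
  rw [le_div_iff₀ hS]
  obtain ⟨h1, h2⟩ := hd v k
  rcases le_or_gt 0 (r v k : ℝ) with hr | hr
  · calc (r v k : ℝ) * d v k * SC = (r v k : ℝ) * (d v k * SC) := by ring
      _ ≤ (r v k : ℝ) * bx.HI v k := mul_le_mul_of_nonneg_left h2 hr
      _ ≤ _ := le_max_right _ _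
  · calc (r v k : ℝ) * d v k * SC = (r v k : ℝ) * (d v k * SC) := by ring
      _ ≤ (r v k : ℝ) * bx.LO v k := mul_le_mul_of_nonpos_left h1 hr.le
      _ ≤ _ := le_max_left _ _

/-- **Soundness of the safe upper bound**: for ANY certificate, `Σ obj·d ≤ certUpper/S`. -/
theorem certUpper_sound {bx : Boxes} {rows : Array Row} {d : Fin 12 → Fin 3 → ℝ}
    (hrows : ∀ r ∈ rows, r.Holds d) (hd : bx.DispIn d) (obj : Fin 12 → Fin 3 → ℤ) (cert : Cert) :
    (∑ v, ∑ k, (obj v k : ℝ) * d v k) ≤ (certUpper bx rows obj cert : ℝ) / SC := by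
  have hS : (0 : ℝ) < SC := by exact_mod_cast SC_pos
  set K : ℕ := max cert.1 1 with hK
  have hK1 : (1 : ℝ) ≤ K := by exact_mod_cast le_max_right cert.1 1
  have hKS : (0 : ℤ) < (K : ℤ) * (SC : ℤ) := by
    have : (0 : ℤ) < K := by exact_mod_cast lt_of_lt_of_le zero_lt_one (le_max_right cert.1 1)
    exact mul_pos this (by exact_mod_cast SC_pos)
  have h1 := termCoeff_sum_le hrows cert.2
  have h2 := residual_sum_le_boxSlack hd (residual rows K obj cert.2)
  have hid : (∑ v, ∑ k, (residual rows K obj cert.2 v k : ℝ) * d v k) =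
      (K : ℝ) * SC * (∑ v, ∑ k, (obj v k : ℝ) * d v k) -
        ∑ v, ∑ k, (termCoeff rows cert.2 v k : ℝ) * d v k := by
    unfold residual
    push_cast
    simp only [sub_mul, Finset.sum_sub_distrib, Finset.mul_sum]
    congr 1
    refine Finset.sum_congr rfl fun v _ => Finset.sum_congr rfl fun k _ => ?_
    ring
  rw [hid] at h2
  have h3 : (K : ℝ) * SC * (∑ v, ∑ k, (obj v k : ℝ) * d v k) ≤
      ((dualBound rows cert.2 : ℝ) + (boxSlack bx (residual rows K obj cert.2) : ℝ)) / SC := by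
    rw [add_div]; linarith
  have h4 := Literature.Analysis.ValidatedNumerics.Numerics.div_le_cdiv
    (a := dualBound rows cert.2 + boxSlack bx (residual rows K obj cert.2)) hKS
  unfold certUpper
  rw [← hK]
  rw [le_div_iff₀ hS]
  have hKSr : (0 : ℝ) < (K : ℝ) * SC := by positivity
  have h5 : (∑ v, ∑ k, (obj v k : ℝ) * d v k) * SC ≤
      ((dualBound rows cert.2 + boxSlack bx (residual rows K obj cert.2) : ℤ) : ℝ) / ((K : ℤ) * (SC : ℤ) : ℤ) := by
    push_cast
    rw [le_div_iff₀ hKSr]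
    rw [le_div_iff₀ hS] at h3
    have : (∑ v, ∑ k, (obj v k : ℝ) * d v k) * SC * ((K : ℝ) * SC) =
        (K : ℝ) * SC * (∑ v, ∑ k, (obj v k : ℝ) * d v k) * SC := by ring
    rw [this]; exact h3
  exact h5.trans h4

/-- **Soundness of the Farkas test**: an accepted certificate contradicts any `d` satisfying the
rows and the box. -/
theorem certInfeasible_sound {bx : Boxes} {rows : Array Row} {d : Fin 12 → Fin 3 → ℝ}
    (hrows : ∀ r ∈ rows, r.Holds d) (hd : bx.DispIn d) {terms : List (ℕ × ℕ)}
    (h : certInfeasible bx rows terms = true) : False := by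
  have hS : (0 : ℝ) < SC := by exact_mod_cast SC_pos
  unfold certInfeasible at h
  rw [decide_eq_true_eq] at h
  have h1 := termCoeff_sum_le hrows terms
  have h2 := residual_sum_le_boxSlack hd (residual rows 1 (fun _ _ => 0) terms)
  have hid : (∑ v, ∑ k, (residual rows 1 (fun _ _ => (0 : ℤ)) terms v k : ℝ) * d v k) =
      -∑ v, ∑ k, (termCoeff rows terms v k : ℝ) * d v k := by
    unfold residual
    push_cast
    simp only [mul_zero, zero_sub, neg_mul, Finset.sum_neg_distrib]
  rw [hid] at h2
  have h3 : (0 : ℝ) ≤ ((dualBound rows terms + boxSlack bx (residual rows 1 (fun _ _ => 0) terms) : ℤ) : ℝ) / SC := by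
    push_cast; rw [add_div]; linarith
  have h4 : ((dualBound rows terms + boxSlack bx (residual rows 1 (fun _ _ => 0) terms) : ℤ) : ℝ) < 0 := by
    exact_mod_cast h
  have := div_neg_of_neg_of_pos h4 hS
  linarith

end Rig

end Summit.AtomisticToContinuum.Crystallization.Theorems
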